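import Summits.BirchSwinnertonDyer.BirchSwinnertonDyer.Theorems.ManinLocalTwoThreeKLineMinimalCubeRootAlgIntPrelims
import HarnessLib

/-!
(RESUBMITTED by p2 g18 for p3 g16 under a new module name (p3's p737534 bounced for sequencing); imports the resubmitted Prelims
`…KLineMinimalCubeRootAlgIntPrelims`, whose §X re-derives the two `…CubeRootComponents` facts used here while the hub lacks that module's olean.)
# (INT)_K: the renormalised cube root of a `K`-point has `3`-bounded algebraic-integer coefficients
(route `ManinLocalTwoThree`, crux C3 `ManinPrimeToThreeAtNine` stmt-BirchSwinnertonDyer-22968; cell bsd-f2-manin, prover seat p3 gen 16 —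
piece (INT)_K of -an g39's `K`-rational UDC line `UDCKummerLineK`, p2 g18's interface; `--supports` 22968)

`exists_algInt_minimalCubeRootC` — p2 g18's interface (16:58:48Z): under the binders of an's (AN)_K (`UDCKummerLineK`), from
`IsShortThreeTorsionC W c X₀ Y₀`, `IsParamGerm`, `h³ = kummerCubeSeriesC …`, `h(0) = −1`, `IsThreeAdicallyBoundedAlg h`:
`∃ g K', (∀ n, _root_.IsIntegral ℤ (3^K'·gₙ)) ∧ g(0) = −1 ∧ c·(z·g) = z_W·h`.  The case `Y₀ ∈ ℚ` is `…MinimalCubeRootAlgIntRat` (p3 g15's integral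
cube root); for `Y₀ ∉ ℚ`: components `h = u + Y₁v` over `ℚ(Y₁)`, `Y₁ = d·Y₀`, `Y₁² = r₁ = 3ᵗr₀ ∈ ℤ` (`…CubeRootComponents`), the conjugate
gives `3`-adic bounds on `u, v`; `g = ρ⁻¹h = U + Y₁V` with the common `ℤ⟦q⟧`-denominator `A = c·3^{K+t}·P′` of `U, V`
(`z ∈ Frac ℤ⟦q⟧`, `exists_int_frac_formalVariableChange_subst`); `g³ = Θ^{min}` splits into the cube system `U³ + 3r₁UV² = Θm₁`,
`3U²V + r₁V³ = Θm₂` with `3ᵉΘmᵢ ∈ ℤ₃⟦q⟧`; the UFD descent in `ℤ₃⟦q⟧` (`…CubeSystemThreeAdic`) bounds the `3`-power denominators of `U, V`;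
away from `3` the coefficients of `g` lie in `ℤ̄[1/3]` (`…AlgIntCubeRootSeries`); Bezout merges (`…AlgIntCubeRoot`).

HONEST FRAMING.  This is the integrality INPUT (INT)_K of the `K`-rational UDC line ((AN♮)_K, p2); nothing about RES₃♭, C3, Manin's
conjecture or BSD is proved here.  No definitions, no sorry.
[cite: SilvermanAEC2009, VII.3.4 (shape) and IV.1; Washington1997, Thm. 7.3 and §7.1 (shape: `ℤ_p⟦T⟧` is a UFD)]
-/

set_option autoImplicit false
-- lint-debt: the directory name repeats the summit name (sibling precedent `ManinLocalTwoThreeMinimalCubeRootAlgIntRat.lean`)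
set_option linter.dupNamespace false

noncomputable section

open scoped Classical
open PowerSeries WeierstrassCurve Literature.NumberTheory.EllipticCurves Literature.NumberTheory.EllipticCurves.ModularForms
open Summit.BirchSwinnertonDyer.Rank1Residual.ManinAdditive.CuspidalKummer
open Summit.BirchSwinnertonDyer.Rank1Residual.ManinAdditive.CuspidalKummerThree
open Summit.BirchSwinnertonDyer.Rank1Residual.ManinAdditive.UDCKummerLine
open Summit.BirchSwinnertonDyer.Rank1Residual.ManinAdditive.UDCKummerLineK

namespace Summit.BirchSwinnertonDyer.BirchSwinnertonDyer.Theorems.ManinLocalTwoThree.MinimalCubeRootC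

/-! ## §4 (INT)_K for a non-rational `K`-point -/

/-- `r₁ ≠ 0` factors as `3ᵗ·r₀` with `3 ∤ r₀`. [folklore] -/
theorem exists_eq_three_pow_mul {r₁ : ℤ} (hr₁ : r₁ ≠ 0) : ∃ (t : ℕ) (r₀ : ℤ), r₁ = 3 ^ t * r₀ ∧ ¬ (3 : ℤ) ∣ r₀ := by
  obtain ⟨t, n', hn'3, hfacN⟩ := Nat.exists_eq_pow_mul_and_not_dvd (Int.natAbs_ne_zero.mpr hr₁) 3 (by norm_num)
  have hn'3Z : ¬ (3 : ℤ) ∣ (n' : ℤ) := fun h ↦ hn'3 (Int.natCast_dvd_natCast.mp h)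
  rcases Int.natAbs_eq r₁ with hpos | hneg
  · exact ⟨t, n', by rw [hpos, hfacN]; push_cast; ring, hn'3Z⟩
  · exact ⟨t, -(n' : ℤ), by rw [hneg, hfacN]; push_cast; ring, fun h ↦ hn'3Z ((dvd_neg).mp h)⟩

/-- **(INT)_K when `Y₀ ∉ ℚ`.**  See the module docstring of `…CubeSystemThreeAdic` / `…CubeRootComponents` for the mechanism.
[cite: SilvermanAEC2009, VII.3.4 and IV.1 (shape)] -/
theorem exists_algInt_minimalCubeRootC_of_not_ratCast (W : WeierstrassCurve ℚ) [W.IsElliptic] [W.IsGloballyMinimal] {N : ℕ} [NeZero N]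
    (D : ModularParametrizationData W N) (a : ℕ → ℤ) (ha : ∀ n, (a n : ℂ) = cuspCoeff D.f n) (X₀ : ℚ) (Y₀ : ℂ)
    (hT : IsShortThreeTorsionC W D.c X₀ Y₀) (hY : ∀ y : ℚ, (y : ℂ) ≠ Y₀) (z : ℚ⟦X⟧) (hz : IsParamGerm W D.c a z) (h : ℂ⟦X⟧)
    (hh3 : h ^ 3 = kummerCubeSeriesC W D.c X₀ Y₀ z) (hh0 : constantCoeff h = -1) (hb : IsThreeAdicallyBoundedAlg h) :
    ∃ (g : ℂ⟦X⟧) (K' : ℕ), (∀ n, _root_.IsIntegral ℤ ((3 : ℂ) ^ K' * coeff n g)) ∧ constantCoeff g = -1 ∧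
      (D.c : ℂ) • (PowerSeries.map (algebraMap ℚ ℂ) z * g) =
        PowerSeries.map (algebraMap ℚ ℂ) (W.formalExp.subst ((D.c : ℚ) • lSeriesLog a)) * h := by
  have hc : D.c ≠ 0 := D.maninConstant_ne_zero_holds
  have hc' : (D.c : ℚ) ≠ 0 := by exact_mod_cast hc
  have hcC : (D.c : ℂ) ≠ 0 := by exact_mod_cast hc
  -- the renormalised cube root `g = R·h` (K3) and the arithmetic of `T` (K2)
  obtain ⟨R, hR0, hR, hg0, hczg, hg3⟩ := exists_minimalCubeRootC W D a ha X₀ Y₀ hz h hh3 hh0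
  obtain ⟨m3, hm3⟩ := MinimalThreeTorsionC.exists_intCast_eq_three_mul W hc hT.2
  have hyT := MinimalThreeTorsionC.isIntegral_nine_mul_yC W hc hT
  have hlamT := MinimalThreeTorsionC.isIntegral_flexSlopeC W hc hT
  obtain ⟨r, hr⟩ := MinimalThreeTorsionC.exists_ratCast_eq_sq hT
  have hY0 : Y₀ ≠ 0 := MinimalThreeTorsionC.y_ne_zero hT
  have hα := tangentSlopeC_eq_ratCast_mul hT hr
  set c : ℤ := D.c with hcdef
  set φ := algebraMap ℚ ℂ with hφ
  set L := lSeriesLog a with hL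
  set zWq := W.formalExp.subst ((c : ℚ) • L) with hzWq
  set Pq := W.formalXMulSq.subst zWq with hPq
  set Ym := W.formalYMulCube.subst zWq with hYm
  set xq : ℚ := X₀ / (c : ℚ) ^ 2 - W.b₂ / 12 with hxq
  have hcL0 : constantCoeff ((c : ℚ) • L) = 0 := ShortGermTransport.constantCoeff_smul_lSeriesLog c a
  have hzW0 : constantCoeff zWq = 0 := ShortGermTransport.constantCoeff_formalExp_subst W hcL0
  -- `Y₁ = d·Y₀`, `Y₁² = r₁ = 3ᵗ·r₀`
  have hrC0 : (r : ℂ) ≠ 0 := by rw [hr]; exact pow_ne_zero 2 hY0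
  have hr0 : r ≠ 0 := fun h0 ↦ hrC0 (by rw [h0, Rat.cast_zero])
  set d : ℚ := (r.den : ℚ) with hd
  have hd0 : d ≠ 0 := by rw [hd]; exact_mod_cast r.den_nz
  set Y₁ : ℂ := (d : ℂ) * Y₀ with hY₁
  set r₁ : ℤ := (r.den : ℤ) * r.num with hr₁
  have hrcast : (r : ℂ) = (r.num : ℂ) / (r.den : ℂ) := by
    rw [← Rat.cast_intCast, ← Rat.cast_natCast, ← Rat.cast_div, Rat.num_div_den]
  have hdenC : (r.den : ℂ) ≠ 0 := by exact_mod_cast r.den_nz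
  have hY₁sq : Y₁ ^ 2 = ((r₁ : ℚ) : ℂ) := by
    rw [hY₁, mul_pow, ← hr, hrcast, hr₁, hd]; push_cast; field_simp
  have hY₁irr : ∀ q : ℚ, (q : ℂ) ≠ Y₁ := fun q hq ↦ hY (q / d) (by
    have hdC : (d : ℂ) ≠ 0 := by exact_mod_cast hd0
    rw [Rat.cast_div, hq, hY₁]; field_simp)
  have hr₁0 : r₁ ≠ 0 := mul_ne_zero (by exact_mod_cast r.den_nz) (Rat.num_ne_zero.mpr hr0)
  obtain ⟨t, r₀, hfac, hr₀3⟩ := exists_eq_three_pow_mul hr₁0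
  -- components of `h` along `1, Y₁` (K4a)
  set κ₀ : ℚ := (3 * X₀ ^ 2 + (shortModel W c).a₄) / (2 * r) with hκ₀
  set Θ' := (shortModel W c).formalYMulCube.subst z with hΘ'
  set Θ'' := -(C d⁻¹ * z ^ 3) - C (κ₀ / d) * ((shortModel W c).formalXMulSq.subst z * z - C X₀ * z ^ 3) with hΘ''
  have hΘdec : kummerCubeSeriesC W c X₀ Y₀ z = PowerSeries.map φ Θ' + C Y₁ * PowerSeries.map φ Θ'' :=
    kummerCubeSeriesC_eq_components W X₀ Y₀ z hd0 hα
  have hz0 : constantCoeff z = 0 := hz.1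
  have hΘ'0 : constantCoeff Θ' = -1 := by
    rw [hΘ', ShortGermTransport.formalYMulCube_subst_eq_neg _ hz0, map_neg, constantCoeff_subst_eq_constantCoeff hz0,
      constantCoeff_formalXMulSq]
  have hΘ''0 : constantCoeff Θ'' = 0 := by simp [hΘ'', hz0]
  obtain ⟨u, v, hhuv, hconj⟩ :=
    exists_components_conj hY₁irr hY₁sq Θ' Θ'' hΘ'0 hΘ''0 h (by rw [hh3, hΘdec]) hh0
  rw [← hφ] at hhuv
  -- `3`-adic bounds on `u, v`
  obtain ⟨K, hK⟩ := hb
  have huv3 : ∀ n, ‖(((3 : ℚ) ^ (K + t) * coeff n u : ℚ) : ℚ_[3])‖ ≤ 1 ∧ ‖(((3 : ℚ) ^ (K + t) * coeff n v : ℚ) : ℚ_[3])‖ ≤ 1 := by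
    intro n
    obtain ⟨M, hM3, hint⟩ := hK n
    have hn : coeff n h = ((coeff n u : ℚ) : ℂ) + Y₁ * ((coeff n v : ℚ) : ℂ) := by
      rw [hhuv, map_add, coeff_map, coeff_C_mul, coeff_map, eq_ratCast, eq_ratCast]
    have hp : _root_.IsIntegral ℤ ((M : ℂ) * 3 ^ K * (((coeff n u : ℚ) : ℂ) + Y₁ * ((coeff n v : ℚ) : ℂ))) := by rw [← hn]; exact hint
    have hm : _root_.IsIntegral ℤ ((M : ℂ) * 3 ^ K * (((coeff n u : ℚ) : ℂ) - Y₁ * ((coeff n v : ℚ) : ℂ))) := by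
      have := hconj n (M * 3 ^ K) (by push_cast; rw [mul_assoc] at hint ⊢; exact hint)
      push_cast at this; rwa [mul_assoc] at this ⊢
    exact norm_le_one_components hY₁sq hfac hr₀3 hM3 hp hm
  -- `U = R·u`, `V = R·v`, `g = U + Y₁ V`
  set U := R * u with hU
  set V := R * v with hV
  have hgUV : PowerSeries.map φ R * h = PowerSeries.map φ U + C Y₁ * PowerSeries.map φ V := by
    rw [hhuv, hU, hV, map_mul (PowerSeries.map φ) R u, map_mul (PowerSeries.map φ) R v]; ring
  -- `Θ^{min}` along `1, Y₁`
  set y' : ℚ := -(W.a₁ * xq + W.a₃) / 2 with hy'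
  set y'' : ℚ := (d * (c : ℚ) ^ 3)⁻¹ with hy''
  set l' : ℚ := -W.a₁ / 2 with hl'
  set l'' : ℚ := κ₀ / (d * c) with hl''
  have hdC : (d : ℂ) ≠ 0 := by exact_mod_cast hd0
  have hyTd : Y₀ / (c : ℂ) ^ 3 - ((W.a₁ : ℂ) * ((xq : ℚ) : ℂ) + W.a₃) / 2 = (y' : ℂ) + Y₁ * (y'' : ℂ) := by
    rw [hY₁, hy', hy'']; push_cast; field_simp; ring
  have hlamd : tangentSlopeC W c X₀ Y₀ / c - (W.a₁ : ℂ) / 2 = (l' : ℂ) + Y₁ * (l'' : ℂ) := by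
    rw [hα, hY₁, hl', hl'']; push_cast; field_simp; ring
  set Θm₁ := Ym - C y' * zWq ^ 3 - C l' * (Pq * zWq - C xq * zWq ^ 3) with hΘm₁
  set Θm₂ := -(C y'' * zWq ^ 3) - C l'' * (Pq * zWq - C xq * zWq ^ 3) with hΘm₂
  have hmin : (PowerSeries.map φ U + C Y₁ * PowerSeries.map φ V) ^ 3 = PowerSeries.map φ Θm₁ + C Y₁ * PowerSeries.map φ Θm₂ := by
    rw [← hgUV, hg3]; exact thetaMin_eq_components Ym Pq zWq xq hyTd hlamd
  have HH := (cube_add_C_mul U V hY₁sq).symm.trans hmin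
  have E1 := PowerSeries.ext fun n ↦ (coeff_eq_of_map_add_C_mul_map_eq hY₁irr HH n).1
  have E2 := PowerSeries.ext fun n ↦ (coeff_eq_of_map_add_C_mul_map_eq hY₁irr HH n).2
  rw [show ((r₁ : ℤ) : ℚ) = (3 : ℚ) ^ t * r₀ by rw [hfac]; push_cast; ring] at E1 E2
  -- integer models of `z_W`, `P`, and `3`-integrality of `Ym, Pq, zWq`
  obtain ⟨Vm, hVm⟩ := (inferInstance : W.IsIntegral ℤ).integral
  set φZ : ℤ →+* ℚ := Int.castRingHom ℚ with hφZ
  have hVW : Vm.map φZ = W := by rw [hVm, hφZ, ← algebraMap_int_eq]; rfl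
  have hzWint : ∀ n, ∃ k : ℤ, coeff n zWq = k := fun n ↦ by
    rw [hzWq, hL, MinimalCubeRoot.lSeriesLog_eq_of_cuspCoeff W D a ha]
    exact DepletionAtTwo.ParamIntegral.exists_int_coeff_formalExp_subst_lSeriesLog W c n
  set zWz : ℤ⟦X⟧ := PowerSeries.mk fun n ↦ (coeff n zWq).num with hzWz
  have hzWmap : PowerSeries.map φZ zWz = zWq := MinimalCubeRoot.map_mk_num_eq hzWint
  have hzWz0 : constantCoeff zWz = 0 := by
    rw [← coeff_zero_eq_constantCoeff_apply, hzWz, coeff_mk, coeff_zero_eq_constantCoeff_apply, hzW0, Rat.num_zero]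
  have hzWzs : HasSubst zWz := HasSubst.of_constantCoeff_zero' hzWz0
  set Pz : ℤ⟦X⟧ := Vm.formalXMulSq.subst zWz with hPz
  have hPmap : PowerSeries.map φZ Pz = Pq := by
    rw [hPz, Literature.RingTheory.FormalGroups.map_subst_apply hzWzs, map_formalXMulSq, hVW, hzWmap]
  have hPint : ∀ n, ∃ k : ℤ, coeff n Pq = k := fun n ↦ ⟨coeff n Pz, by rw [← hPmap, coeff_map, hφZ, eq_intCast]⟩
  have hYmP : Ym = -Pq := ShortGermTransport.formalYMulCube_subst_eq_neg W hzW0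
  set ι : ℚ⟦X⟧ →+* ℚ_[3]⟦X⟧ := PowerSeries.map (algebraMap ℚ ℚ_[3]) with hι
  set κ : ℤ_[3]⟦X⟧ →+* ℚ_[3]⟦X⟧ := PowerSeries.map (PadicInt.Coe.ringHom (p := 3)) with hκ
  set ψ : ℤ⟦X⟧ →+* ℤ_[3]⟦X⟧ := PowerSeries.map (Int.castRingHom ℤ_[3]) with hψ
  have hκint : ∀ G : ℤ_[3]⟦X⟧, IsPadicInt (κ G) := fun G ↦ isPadicInt_iff_exists_powerSeries_map.mpr ⟨G, rfl⟩
  have hικ : ∀ G : ℤ⟦X⟧, ι (PowerSeries.map φZ G) = κ (ψ G) := fun G ↦ by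
    rw [hι, hκ, hψ, hφZ]
    change ((PowerSeries.map (algebraMap ℚ ℚ_[3])).comp (PowerSeries.map (Int.castRingHom ℚ))) G =
      ((PowerSeries.map (PadicInt.Coe.ringHom (p := 3))).comp (PowerSeries.map (Int.castRingHom ℤ_[3]))) G
    rw [← PowerSeries.map_comp, ← PowerSeries.map_comp, RingHom.ext_int ((algebraMap ℚ ℚ_[3]).comp (Int.castRingHom ℚ))
      ((PadicInt.Coe.ringHom (p := 3)).comp (Int.castRingHom ℤ_[3]))]
  have hιzW : IsPadicInt (ι zWq) := by rw [← hzWmap, hικ]; exact hκint _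
  have hιP : IsPadicInt (ι Pq) := by rw [← hPmap, hικ]; exact hκint _
  have hιYm : IsPadicInt (ι Ym) := by rw [hYmP, map_neg]; exact hιP.neg
  obtain ⟨e₁, he₁⟩ := exists_isPadicInt_thetaMin Ym Pq zWq hιYm hιP hιzW xq y' l'
  obtain ⟨e₂, he₂⟩ := exists_isPadicInt_thetaMin 0 Pq zWq (by rw [map_zero]; exact IsPadicInt.zero) hιP hιzW xq y'' l''
  rw [zero_sub] at he₂
  have hΘ₁ := isPadicInt_C_pow_mul_mono (Nat.le_add_right e₁ e₂) he₁
  have hΘ₂ := isPadicInt_C_pow_mul_mono (Nat.le_add_left e₂ e₁) he₂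
  -- the common `ℤ⟦q⟧`-denominator `A = c·3^{K+t}·P′` of `U, V` (`z ∈ Frac ℤ⟦q⟧`)
  set vc : VariableChange ℚ := ⟨Units.mk0 ((c : ℚ)⁻¹) (inv_ne_zero hc'), -(W.b₂ / 12), -(W.a₁ / 2),
    W.a₁ * W.b₂ / 24 - W.a₃ / 2⟩ with hvc
  have hzθ : z = (W.formalVariableChange vc).subst zWq :=
    ShortGermTransport.shortGerm_eq_formalVariableChange_subst W hc vc (by rw [hvc, Units.val_mk0]) rfl rfl rfl a hz
  have hwmap : W.formalW.subst zWq * PowerSeries.map φZ (1 : ℤ⟦X⟧) = PowerSeries.map φZ (Vm.formalW.subst zWz) := by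
    rw [map_one, mul_one, Literature.RingTheory.FormalGroups.map_subst_apply hzWzs, map_formalW, hVW, hzWmap]
  have hzmap : zWq * PowerSeries.map φZ (1 : ℤ⟦X⟧) = PowerSeries.map φZ zWz := by rw [map_one, mul_one, hzWmap]
  obtain ⟨P', Q', hQ'0, hPQ'⟩ := W.exists_int_frac_formalVariableChange_subst vc hzW0 one_ne_zero hzmap one_ne_zero hwmap
  rw [← hzθ] at hPQ'
  have hz1 : coeff 1 z = 1 := MinimalCubeRoot.coeff_one_shortGerm W D a ha hz
  have hzne : z ≠ 0 := fun h0 ↦ by rw [h0, map_zero] at hz1; exact zero_ne_one hz1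
  have hP'ne : P' ≠ 0 := by
    intro h0
    have e : z * PowerSeries.map φZ Q' = 0 := by rw [hPQ', h0, map_zero]
    rcases mul_eq_zero.mp e with h1 | h1
    · exact hzne h1
    · exact hQ'0 (PowerSeries.map_injective φZ Int.cast_injective (by rw [h1, map_zero]))
  set A : ℤ⟦X⟧ := C ((c * 3 ^ (K + t) : ℤ)) * P' with hA
  have hAne : A ≠ 0 := by
    rw [hA]
    refine mul_ne_zero ?_ hP'ne
    intro h0
    have h1 := congrArg constantCoeff h0
    rw [constantCoeff_C, map_zero] at h1
    exact mul_ne_zero hc (pow_ne_zero _ (by norm_num)) h1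
  have hkey : C (c : ℚ) * PowerSeries.map φZ P' * R = zWq * PowerSeries.map φZ Q' := by
    rw [← hPQ']; linear_combination (PowerSeries.map φZ Q') * hR
  have hAU : PowerSeries.map φZ A * U = zWq * PowerSeries.map φZ Q' * (C ((3 : ℚ) ^ (K + t)) * u) := by
    rw [hA, map_mul, PowerSeries.map_C, hU, show φZ ((c * 3 ^ (K + t) : ℤ)) = (c : ℚ) * (3 : ℚ) ^ (K + t) by simp [hφZ],
      map_mul C]
    linear_combination (C ((3 : ℚ) ^ (K + t)) * u) * hkey
  have hAV : PowerSeries.map φZ A * V = zWq * PowerSeries.map φZ Q' * (C ((3 : ℚ) ^ (K + t)) * v) := by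
    rw [hA, map_mul, PowerSeries.map_C, hV, show φZ ((c * 3 ^ (K + t) : ℤ)) = (c : ℚ) * (3 : ℚ) ^ (K + t) by simp [hφZ],
      map_mul C]
    linear_combination (C ((3 : ℚ) ^ (K + t)) * v) * hkey
  have hιu : IsPadicInt (ι (C ((3 : ℚ) ^ (K + t)) * u)) := isPadicInt_iff_coeff.mpr fun n ↦ by
    rw [hι, coeff_map, coeff_C_mul, eq_ratCast]; exact (huv3 n).1
  have hιv : IsPadicInt (ι (C ((3 : ℚ) ^ (K + t)) * v)) := isPadicInt_iff_coeff.mpr fun n ↦ by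
    rw [hι, coeff_map, coeff_C_mul, eq_ratCast]; exact (huv3 n).2
  have hιQ : IsPadicInt (ι (PowerSeries.map φZ Q')) := by rw [hικ]; exact hκint _
  have hIU : IsPadicInt (ι (PowerSeries.map φZ A * U)) := by rw [hAU, map_mul, map_mul]; exact (hιzW.mul hιQ).mul hιu
  have hIV : IsPadicInt (ι (PowerSeries.map φZ A * V)) := by rw [hAV, map_mul, map_mul]; exact (hιzW.mul hιQ).mul hιv
  -- the descent (K4b/K4c-2a)
  obtain ⟨hUint, hVint⟩ := CubeSystemDescent.isPadicInt_of_cube_system hAne hr₀3 hIU hIV hΘ₁ hΘ₂ E1 E2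
  -- `M`-forms for the coefficients of `g`
  have hY₁int : _root_.IsIntegral ℤ Y₁ :=
    MinimalThreeTorsionC.isIntegral_of_monic_quadratic 0 (-r₁) (by push_cast; rw [hY₁sq]; push_cast; ring)
  have hMform : ∀ n, ∃ M : ℕ, ¬ 3 ∣ M ∧ _root_.IsIntegral ℤ ((M : ℂ) * 3 ^ (e₁ + e₂ + t) * coeff n (PowerSeries.map φ R * h)) := by
    intro n
    have hUn := (isPadicInt_iff_coeff.mp hUint) n
    have hVn := (isPadicInt_iff_coeff.mp hVint) n
    rw [coeff_map, coeff_C_mul, eq_ratCast] at hUn hVn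
    set qu : ℚ := (3 : ℚ) ^ (e₁ + e₂ + t) * coeff n U with hqu
    set qv : ℚ := (3 : ℚ) ^ (e₁ + e₂ + t) * coeff n V with hqv
    have hdu := not_dvd_den_of_norm_ratCast_le_one hUn
    have hdv := not_dvd_den_of_norm_ratCast_le_one hVn
    refine ⟨qu.den * qv.den, fun h3 ↦ ((Nat.Prime.dvd_mul Nat.prime_three).mp h3).elim hdu hdv, ?_⟩
    have hgn : coeff n (PowerSeries.map φ R * h) = ((coeff n U : ℚ) : ℂ) + Y₁ * ((coeff n V : ℚ) : ℂ) := by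
      rw [hgUV, map_add, coeff_map, coeff_C_mul, coeff_map, hφ, eq_ratCast, eq_ratCast]
    have e : ((qu.den * qv.den : ℕ) : ℂ) * 3 ^ (e₁ + e₂ + t) * (((coeff n U : ℚ) : ℂ) + Y₁ * ((coeff n V : ℚ) : ℂ)) =
        (((qv.den : ℤ) * qu.num : ℤ) : ℂ) + (((qu.den : ℤ) * qv.num : ℤ) : ℂ) * Y₁ := by
      have h1 := Rat.den_mul_eq_num qu
      have h2 := Rat.den_mul_eq_num qv
      rw [hqu] at h1; rw [hqv] at h2
      have h1' := congrArg (fun q : ℚ ↦ (q : ℂ)) h1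
      have h2' := congrArg (fun q : ℚ ↦ (q : ℂ)) h2
      push_cast at h1' h2' ⊢
      linear_combination ((qv.den : ℂ)) * h1' + ((qu.den : ℂ) * Y₁) * h2'
    rw [hgn, e]
    exact isIntegral_algebraMap.add (isIntegral_algebraMap.mul hY₁int)
  -- step A (K1) and the merge
  have hg3' : (PowerSeries.map φ R * h) ^ 3 = -PowerSeries.map φ Pq
      - C (Y₀ / (c : ℂ) ^ 3 - ((W.a₁ : ℂ) * ((xq : ℚ) : ℂ) + W.a₃) / 2) * PowerSeries.map φ zWq ^ 3
      - C (tangentSlopeC W c X₀ Y₀ / c - (W.a₁ : ℂ) / 2)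
          * (PowerSeries.map φ Pq * PowerSeries.map φ zWq - C ((xq : ℚ) : ℂ) * PowerSeries.map φ zWq ^ 3) := by
    rw [hg3, hYmP, map_neg]
  have hstepA := AlgIntCubeRoot.exists_isIntegral_pow_mul_coeff_of_cube hPint hzWint ⟨m3, hm3⟩ hyT hlamT hg0 hg3'
  refine ⟨PowerSeries.map φ R * h, e₁ + e₂ + t, fun n ↦ ?_, hg0, hczg⟩
  obtain ⟨M, hM3, hM⟩ := hMform n
  exact AlgIntCubeRoot.isIntegral_pow_mul_of_exists hM3 hM (hstepA n)

/-! ## §5 (INT)_K -/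

/-- **(INT)_K (p2 g18's interface for the `K`-rational UDC line of RES₃♭).**  For a globally minimal `W`, a modular parametrisation
datum `D` (`c = D.c`), `aₙ = aₙ(f)`, a `K`-point `T = (X₀, Y₀)` of order `3` of `E_{W,c}` with RATIONAL abscissa (`IsShortThreeTorsionC`),
the short germ `z` (`IsParamGerm`) and a normalised cube root `h` of the tangent-line Kummer series `Θ_T` (`kummerCubeSeriesC`) that is
`3`-adically bounded at the primes over `3` (`IsThreeAdicallyBoundedAlg`): the renormalised cube root `g = ρ⁻¹h` on the MINIMAL model has
`g(0) = −1`, `c·(z·g) = z_W·h` (`z_W = exp_W(c·Σaₙqⁿ/n)`), and `3^{K'}·gₙ` an ALGEBRAIC INTEGER for every `n`, for one `K'`.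
Nothing about C3, Manin's conjecture or BSD is proved by this. [cite: SilvermanAEC2009, VII.3.4 and IV.1 (shape)] -/
theorem exists_algInt_minimalCubeRootC (W : WeierstrassCurve ℚ) [W.IsElliptic] [W.IsGloballyMinimal] {N : ℕ} [NeZero N]
    (D : ModularParametrizationData W N) (a : ℕ → ℤ) (ha : ∀ n, (a n : ℂ) = cuspCoeff D.f n) (X₀ : ℚ) (Y₀ : ℂ)
    (hT : IsShortThreeTorsionC W D.c X₀ Y₀) (z : ℚ⟦X⟧) (hz : IsParamGerm W D.c a z) (h : ℂ⟦X⟧)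
    (hh3 : h ^ 3 = kummerCubeSeriesC W D.c X₀ Y₀ z) (hh0 : constantCoeff h = -1) (hb : IsThreeAdicallyBoundedAlg h) :
    ∃ (g : ℂ⟦X⟧) (K' : ℕ), (∀ n, _root_.IsIntegral ℤ ((3 : ℂ) ^ K' * coeff n g)) ∧ constantCoeff g = -1 ∧
      (D.c : ℂ) • (PowerSeries.map (algebraMap ℚ ℂ) z * g) =
        PowerSeries.map (algebraMap ℚ ℂ) (W.formalExp.subst ((D.c : ℚ) • lSeriesLog a)) * h := by
  by_cases hrat : ∃ y : ℚ, (y : ℂ) = Y₀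
  · obtain ⟨y, rfl⟩ := hrat
    exact exists_algInt_minimalCubeRootC_of_ratCast W D a ha X₀ y hT z hz h hh3 hh0 hb
  · simp only [not_exists] at hrat
    exact exists_algInt_minimalCubeRootC_of_not_ratCast W D a ha X₀ Y₀ hT hrat z hz h hh3 hh0 hb

end Summit.BirchSwinnertonDyer.BirchSwinnertonDyer.Theorems.ManinLocalTwoThree.MinimalCubeRootC

end
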